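import Summits.Langlands.Langlands.Theses.HolomorphicShadow
import Summits.Langlands.Langlands.Theorems.IrreducibilityBySelfDualityReciprocityUpToIrreducibilityIsobaricRigidity

/-!
BC3 birth skeleton — child `IsobaricRigidityUnramified` of `HolomorphicShadow.SectorComplement` (stmt-Langlands-14623),
crux-strategist planner-cstrat-stmt-Langlands-14623-r1-0, 2026-08-17.  Named stubs (the ONLY sorries) = the route's two EXISTING
Jacquet–Shalika items BY NAME (PairLBoundaryJS = stmt-Langlands-13622, PairLPoleJS = stmt-Langlands-19093, Arthur–Clozel Ch. 3
(2.2)/(2.3) for Borel–Jacquet data, THEOREMS in print hanging on their `L²` leaves), and `IsobaricRigidityUnramified_of : stubs →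
IsobaricRigidityUnramified` = the landed `ReciprocityUpToIrreducibility.stub_isobaricRigidity` (p105601; the items' texts are δ-equal
to the Literature named facts).  Context = the route file's (child restated verbatim; after the split the `def` is deleted).
-/

set_option linter.dupNamespace false

namespace Summit.Langlands.Langlands.Theses.HolomorphicShadow

open scoped BigOperators Topology Manifold Classical MeasureTheory ProbabilityTheory Matrix InnerProductSpace ComplexConjugate ContinuousMap
open Filter Set Function TopologicalSpace MeasureTheory

/-- Piece IR — isobaric rigidity at the unramified places (pre-split stand-in; byte-identical with children.json). -/
def IsobaricRigidityUnramified : Prop :=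
  ∀ (K : Type) [Field K] [NumberField K] (n : ℕ) (hcpt : Literature.NumberTheory.Automorphic.isCompact_glFiniteIntegralLevel n K) (π : Literature.NumberTheory.Automorphic.CuspidalAutomorphicRepData n K hcpt) (k : ℕ) (m : Fin k → ℕ) (hm : ∀ i, Literature.NumberTheory.Automorphic.isCompact_glFiniteIntegralLevel (m i) K) (σ : ∀ i, Literature.NumberTheory.Automorphic.CuspidalAutomorphicRepData (m i) K (hm i)), 0 < n → 2 ≤ k → (∀ i, 0 < m i) → ¬ ∀ᶠ v : IsDedekindDomain.HeightOneSpectrum (NumberField.RingOfIntegers K) in cofinite, ∀ α : Multiset ℂ, π.1.HasSatakeParamAt v α → ∃ β : Fin k → Multiset ℂ, (∀ i, (σ i).1.HasSatakeParamAt v (β i)) ∧ α = ∑ i, β i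

namespace Cruxes.IsobaricRigidityUnramified.Birth

/-- **stub JS (2.2)** — the route item `PairLBoundaryJS` (stmt-Langlands-13622) BY NAME: off the X-condition the partial Rankin–Selberg
product of two cuspidal Borel–Jacquet data has a finite non-zero boundary value on `Re s = 1`.
[cite: ArthurClozelAMS120, Ch. 3 §2 (2.2)] [cite: JacquetShalikaAJM1981II, Prop. 3.6] -/
theorem stub_pairLBoundaryJS : PairLBoundaryJS := by
  sorry

/-- **stub JS (2.3)** — the route item `PairLPoleJS` (stmt-Langlands-19093) BY NAME: on the X-condition the product has a simple pole
with non-zero residue. [cite: ArthurClozelAMS120, Ch. 3 §2 (2.3)] [cite: JacquetShalikaAJM1981II, Prop. 3.6] -/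
theorem stub_pairLPoleJS : PairLPoleJS := by
  sorry

/-- **IR from the two Jacquet–Shalika inputs** — the landed structural `stub_isobaricRigidity` (unitary normalisation, Rankin–Selberg
factorisation against the contragredient of the constituent of maximal real twist, pole count at `s = 1`). -/
theorem IsobaricRigidityUnramified_of (h22 : PairLBoundaryJS) (h23 : PairLPoleJS) : IsobaricRigidityUnramified :=
  fun K _ _ n hcpt π k m hm σ hn hk hm0 =>
    Summit.Langlands.Langlands.Theorems.ReciprocityUpToIrreducibility.stub_isobaricRigidity h22 h23 K n hcpt π k m hm σ hn hk hm0

/-- The composition with the stubs plugged in: `IsobaricRigidityUnramified` modulo exactly {JS (2.2), JS (2.3)}. -/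
theorem IsobaricRigidityUnramified_of_stubs : IsobaricRigidityUnramified :=
  IsobaricRigidityUnramified_of stub_pairLBoundaryJS stub_pairLPoleJS

end Cruxes.IsobaricRigidityUnramified.Birth

end Summit.Langlands.Langlands.Theses.HolomorphicShadow
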